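import Summits.Ventures.Crystal3D.Theorems.StickyWulffConstantNoReconstructionGainGrainFrameBudget
import Summits.Ventures.Crystal3D.Theorems.StickyWulffConstantNoReconstructionGainGrainFrameSplB
import Summits.Ventures.Crystal3D.Theorems.StickyWulffConstantNoReconstructionGainCubicChamber
import HarnessLib

/-!
# The cap budget of a moved fcc bond star for at most two contacts

HONEST FRAMING. Part of the venture `Summits/Ventures/Crystal3D` (cell `crystal3d-full`), helper
`--supports` the crux `NoReconstructionGain` (stmt-Ventures-19144, route
`route-Ventures-StickyWulffConstant`), line `adhesion` (wulff-p1 g11).  Second brick of the open stub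
`stub_frameCapBudget` (skeleton v12/v13; the spherical CAP BUDGET of a moved bond star `A U₀`, which by
`grainFilm_slab_of_capBudget` gives the adhesion atom for misoriented fcc grains at every normal):

* `cubic_inner` — the three cubic coordinates `A, B, C` (`…CubicActions`) form `√2 ×` an orthonormal
  frame: `2⟪p, q⟫ = A_p A_q + B_p B_q + C_p C_q`; `inner_bonds_cubic` — the bonds `u, v, t` of the model
  frame pair with any `w` as `(A+B)/2, (A+C)/2, (B+C)/2`.
* `frameCapBudget_two_sorted` — the budget for exactly two contacts when the cubic coordinates of the
  pulled-back pole `A⁻¹(−ν)` are sorted, `0 ≤ a ≤ b ≤ c`: DICHOTOMY — if `t ≤ (a+c)/2` the two deepest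
  star directions `A t, A v` are steep; otherwise a contact `u ≠ A t` is strictly deeper than `A v` and
  the single-point blocking lemma `spl2_coords` (`…GrainFrameSplB`) gives two distinct strictly-down
  star directions within `60°` of `u`.
* `frameCapBudget_card_le_two` (**rung**, registered by name on stmt-Ventures-19144) — THE CAP BUDGET
  FOR `#K ≤ 2`, every `t > 0`, every rotation `A`, every normal: the chamber step
  `exists_latticeIsometry_cubic_sorted_nonneg` (`…CubicChamber`) replaces `A` by `A ∘ g⁻¹` for a
  lattice isometry `g`, which leaves the moved star `A U₀` unchanged.

So a misoriented-grain film each of whose balls touches AT MOST TWO substrate balls gains nothing, at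
every normal (composition with the per-ball reduction: next file).

WHAT THIS IS NOT: the three-contact case of the budget (hollow-site adsorption) is open; rung F-C1 not
moved.
-/

noncomputable section

namespace Summit.Ventures.Crystal3D.Theorems

open Summit.Ventures.Crystal3D Finset
open Literature.MathematicalPhysics.StatisticalMechanics (fccStacking barlowPos constHagg barlowPos_mem)
open scoped InnerProductSpace

/-! ## Cubic coordinates -/

/-- **The cubic coordinates are `√2 ×` orthonormal:** `2⟪p, q⟫ = A_p A_q + B_p B_q + C_p C_q`. -/
theorem cubic_inner (p q : EuclideanSpace ℝ (Fin 3)) :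
    2 * ⟪p, q⟫_ℝ =
      (p 0 + Real.sqrt 3 / 3 * p 1 - Real.sqrt (2 / 3) * p 2) * (q 0 + Real.sqrt 3 / 3 * q 1 - Real.sqrt (2 / 3) * q 2)
      + (p 0 - Real.sqrt 3 / 3 * p 1 + Real.sqrt (2 / 3) * p 2) * (q 0 - Real.sqrt 3 / 3 * q 1 + Real.sqrt (2 / 3) * q 2)
      + (2 * Real.sqrt 3 / 3 * p 1 + Real.sqrt (2 / 3) * p 2) * (2 * Real.sqrt 3 / 3 * q 1 + Real.sqrt (2 / 3) * q 2) := by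
  have h3 : Real.sqrt 3 ^ 2 = 3 := Real.sq_sqrt (by norm_num)
  have hp : (Real.sqrt 3 / 3) ^ 2 = 1 / 3 := by rw [div_pow, h3]; norm_num
  have hq : Real.sqrt (2 / 3) ^ 2 = 2 / 3 := Real.sq_sqrt (by norm_num)
  have hin : ⟪p, q⟫_ℝ = p 0 * q 0 + p 1 * q 1 + p 2 * q 2 := by
    simp [PiLp.inner_apply, Fin.sum_univ_three, mul_comm]
  rw [hin]
  linear_combination (-(6 * p 1 * q 1)) * hp + (-(3 * p 2 * q 2)) * hq

/-- Inner products of the model bonds `u, v, t` with any `w` in cubic coordinates: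
`(A+B)/2, (A+C)/2, (B+C)/2`. -/
theorem inner_bonds_cubic (w : EuclideanSpace ℝ (Fin 3)) :
    ⟪barlowPos 1 (Real.sqrt (2 / 3)) constHagg 0 1 0, w⟫_ℝ =
      ((w 0 + Real.sqrt 3 / 3 * w 1 - Real.sqrt (2 / 3) * w 2) + (w 0 - Real.sqrt 3 / 3 * w 1 + Real.sqrt (2 / 3) * w 2)) / 2 ∧
    ⟪barlowPos 1 (Real.sqrt (2 / 3)) constHagg 0 0 1, w⟫_ℝ =
      ((w 0 + Real.sqrt 3 / 3 * w 1 - Real.sqrt (2 / 3) * w 2) + (2 * Real.sqrt 3 / 3 * w 1 + Real.sqrt (2 / 3) * w 2)) / 2 ∧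
    ⟪barlowPos 1 (Real.sqrt (2 / 3)) constHagg 1 0 0, w⟫_ℝ =
      ((w 0 - Real.sqrt 3 / 3 * w 1 + Real.sqrt (2 / 3) * w 2) + (2 * Real.sqrt 3 / 3 * w 1 + Real.sqrt (2 / 3) * w 2)) / 2 := by
  obtain ⟨hu, hv, ht⟩ := inner_bonds_apply w
  rw [hu, hv, ht]
  refine ⟨by ring, by ring, by ring⟩

/-- Two distinct members of `U` with a property give `2 ≤ #filter`. -/
theorem two_le_card_filter_of_pair {U : Finset (EuclideanSpace ℝ (Fin 3))}
    {P : EuclideanSpace ℝ (Fin 3) → Prop} [DecidablePred P] {d d' : EuclideanSpace ℝ (Fin 3)}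
    (hd : d ∈ U) (hd' : d' ∈ U) (hne : d ≠ d') (hP : P d) (hP' : P d') : 2 ≤ (U.filter P).card := by
  classical
  have hsub : ({d, d'} : Finset (EuclideanSpace ℝ (Fin 3))) ⊆ U.filter P := by
    intro e he
    rcases mem_insert.1 he with rfl | he
    · exact mem_filter.2 ⟨hd, hP⟩
    · rw [mem_singleton] at he; rw [he]; exact mem_filter.2 ⟨hd', hP'⟩
  have := card_le_card hsub
  rwa [card_pair hne] at this

/-- The cubic coordinates `(0, 1, 1)` single out the bond `t = barlowPos 1 √(2/3) constHagg 1 0 0`. -/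
theorem eq_bondT_of_cubic (w : EuclideanSpace ℝ (Fin 3))
    (hA0 : w 0 + Real.sqrt 3 / 3 * w 1 - Real.sqrt (2 / 3) * w 2 = 0)
    (hB1 : w 0 - Real.sqrt 3 / 3 * w 1 + Real.sqrt (2 / 3) * w 2 = 1)
    (hC1 : 2 * Real.sqrt 3 / 3 * w 1 + Real.sqrt (2 / 3) * w 2 = 1) :
    w = barlowPos 1 (Real.sqrt (2 / 3)) constHagg 1 0 0 := by
  obtain ⟨-, -, ⟨t0, t1, t2⟩⟩ := bond_coords
  have hs3 : Real.sqrt 3 * Real.sqrt 3 = 3 := Real.mul_self_sqrt (by norm_num)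
  have hq23 : Real.sqrt (2 / 3) * Real.sqrt (2 / 3) = 2 / 3 := Real.mul_self_sqrt (by norm_num)
  have hq0 : Real.sqrt (2 / 3) ≠ 0 := (Real.sqrt_pos.2 (by norm_num)).ne'
  have h30 : Real.sqrt 3 ≠ 0 := (Real.sqrt_pos.2 (by norm_num)).ne'
  have h0 : w 0 = 1 / 2 := by linear_combination (hA0 + hB1) / 2
  have e2 : 3 * Real.sqrt (2 / 3) * (w 2 - Real.sqrt (2 / 3)) = 0 := by
    linear_combination (hB1 - hA0 + hC1) - 3 * hq23
  have h2 : w 2 = Real.sqrt (2 / 3) := by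
    rcases mul_eq_zero.1 e2 with h | h
    · exact absurd h (by positivity)
    · linarith
  have e1 : 2 * Real.sqrt 3 / 3 * (w 1 - Real.sqrt 3 / 6) = 0 := by
    rw [h2] at hC1
    linear_combination hC1 - hq23 - (1 / 9) * hs3
  have h1 : w 1 = Real.sqrt 3 / 6 := by
    rcases mul_eq_zero.1 e1 with h | h
    · exact absurd h (by positivity)
    · linarith
  refine PiLp.ext fun i => ?_
  fin_cases i
  · exact h0.trans t0.symm
  · exact h1.trans t1.symm
  · exact h2.trans t2.symm

/-- Unit lattice vectors by coordinates: `barlowPos 1 √(2/3) constHagg k i j` with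
`i² + j² + k² + ij + ik + jk = 1` is a unit vector of `Λ₀`, hence its image lies in the moved star. -/
theorem movedStar_mem_of_coords (U₀ : Finset (EuclideanSpace ℝ (Fin 3)))
    (hU₀ : ∀ d ∈ U₀, d ∈ fccStacking 1 (Real.sqrt (2 / 3)) ∧ ‖d‖ = 1) (hU₀card : U₀.card = 12)
    (A : EuclideanSpace ℝ (Fin 3) ≃ₗᵢ[ℝ] EuclideanSpace ℝ (Fin 3)) {k i j : ℤ}
    (h : i ^ 2 + j ^ 2 + k ^ 2 + i * j + i * k + j * k = 1) :
    A (barlowPos 1 (Real.sqrt (2 / 3)) constHagg k i j) ∈ U₀.image fun d => A d := by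
  classical
  exact mem_image.2 ⟨_, fcc_unit_mem_of_bondStar U₀ hU₀ hU₀card (barlowPos_mem _ _ _)
    (norm_barlowPos_fcc_eq_one h), rfl⟩

set_option maxHeartbeats 800000 in
/-- **The cap budget for two contacts, sorted pole.**  See the module docstring. -/
theorem frameCapBudget_two_sorted (U₀ : Finset (EuclideanSpace ℝ (Fin 3)))
    (hU₀ : ∀ d ∈ U₀, d ∈ fccStacking 1 (Real.sqrt (2 / 3)) ∧ ‖d‖ = 1) (hU₀card : U₀.card = 12)
    (A : EuclideanSpace ℝ (Fin 3) ≃ₗᵢ[ℝ] EuclideanSpace ℝ (Fin 3))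
    (ν : EuclideanSpace ℝ (Fin 3)) (hν : ‖ν‖ = 1) (t : ℝ)
    (K : Finset (EuclideanSpace ℝ (Fin 3))) (hK : K.card = 2)
    (hK1 : ∀ u ∈ K, ‖u‖ = 1 ∧ ⟪u, ν⟫_ℝ ≤ -t)
    (hsort : 0 ≤ (A.symm (-ν)) 0 + Real.sqrt 3 / 3 * (A.symm (-ν)) 1 - Real.sqrt (2 / 3) * (A.symm (-ν)) 2 ∧
      (A.symm (-ν)) 0 + Real.sqrt 3 / 3 * (A.symm (-ν)) 1 - Real.sqrt (2 / 3) * (A.symm (-ν)) 2 ≤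
        (A.symm (-ν)) 0 - Real.sqrt 3 / 3 * (A.symm (-ν)) 1 + Real.sqrt (2 / 3) * (A.symm (-ν)) 2 ∧
      (A.symm (-ν)) 0 - Real.sqrt 3 / 3 * (A.symm (-ν)) 1 + Real.sqrt (2 / 3) * (A.symm (-ν)) 2 ≤
        2 * Real.sqrt 3 / 3 * (A.symm (-ν)) 1 + Real.sqrt (2 / 3) * (A.symm (-ν)) 2) :
    (2 : ℝ) ≤
      (((U₀.image fun d => A d).filter fun d =>
          ⟪d, ν⟫_ℝ < 0 ∧ ((∃ u ∈ K, 1 / 2 < ⟪u, d⟫_ℝ) ∨ ⟪d, ν⟫_ℝ ≤ -t)).card : ℝ) := by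
  classical
  -- the pole and its cubic coordinates
  set S := A.symm (-ν) with hSdef
  set a := S 0 + Real.sqrt 3 / 3 * S 1 - Real.sqrt (2 / 3) * S 2 with hadef
  set b := S 0 - Real.sqrt 3 / 3 * S 1 + Real.sqrt (2 / 3) * S 2 with hbdef
  set c := 2 * Real.sqrt 3 / 3 * S 1 + Real.sqrt (2 / 3) * S 2 with hcdef
  obtain ⟨ha, hab, hbc⟩ := hsort
  have hSn : ‖S‖ = 1 := by rw [hSdef, LinearIsometryEquiv.norm_map, norm_neg, hν]
  have hS2 : a ^ 2 + b ^ 2 + c ^ 2 = 2 := by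
    have h := cubic_inner S S
    rw [real_inner_self_eq_norm_sq, hSn] at h
    rw [hadef, hbdef, hcdef]; nlinarith [h]
  have hc0 : 0 < c := by nlinarith
  -- inner products with `ν` through `S`
  have hνS : ∀ w : EuclideanSpace ℝ (Fin 3), ⟪A w, ν⟫_ℝ = -⟪w, S⟫_ℝ := by
    intro w
    have : ⟪w, S⟫_ℝ = -⟪A w, ν⟫_ℝ := by
      rw [hSdef, ← A.inner_map_map, LinearIsometryEquiv.apply_symm_apply, inner_neg_right]
    linarith
  -- the six witness directions: t = bp 1 0 0, v = bp 0 0 1, u = bp 0 1 0 and t−u, v−u, t−v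
  have e_tu : barlowPos 1 (Real.sqrt (2 / 3)) constHagg 1 (-1) 0 = barlowPos 1 (Real.sqrt (2 / 3)) constHagg 1 0 0 - barlowPos 1 (Real.sqrt (2 / 3)) constHagg 0 1 0 := by
    rw [barlowPos_fcc_sub]; norm_num
  have e_vu : barlowPos 1 (Real.sqrt (2 / 3)) constHagg 0 (-1) 1 = barlowPos 1 (Real.sqrt (2 / 3)) constHagg 0 0 1 - barlowPos 1 (Real.sqrt (2 / 3)) constHagg 0 1 0 := by
    rw [barlowPos_fcc_sub]; norm_num
  have e_tv : barlowPos 1 (Real.sqrt (2 / 3)) constHagg 1 0 (-1) = barlowPos 1 (Real.sqrt (2 / 3)) constHagg 1 0 0 - barlowPos 1 (Real.sqrt (2 / 3)) constHagg 0 0 1 := by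
    rw [barlowPos_fcc_sub]; norm_num
  have m_t := movedStar_mem_of_coords U₀ hU₀ hU₀card A (k := 1) (i := 0) (j := 0) (by norm_num)
  have m_v := movedStar_mem_of_coords U₀ hU₀ hU₀card A (k := 0) (i := 0) (j := 1) (by norm_num)
  have m_u := movedStar_mem_of_coords U₀ hU₀ hU₀card A (k := 0) (i := 1) (j := 0) (by norm_num)
  have m_tu := movedStar_mem_of_coords U₀ hU₀ hU₀card A (k := 1) (i := -1) (j := 0) (by norm_num)
  have m_vu := movedStar_mem_of_coords U₀ hU₀ hU₀card A (k := 0) (i := -1) (j := 1) (by norm_num)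
  have m_tv := movedStar_mem_of_coords U₀ hU₀ hU₀card A (k := 1) (i := 0) (j := -1) (by norm_num)
  have ne : ∀ {k i j k' i' j' : ℤ}, (k, i, j) ≠ (k', i', j') → barlowPos 1 (Real.sqrt (2 / 3)) constHagg k i j ≠ barlowPos 1 (Real.sqrt (2 / 3)) constHagg k' i' j' :=
    fun hne h => hne (barlowPos_fcc_injective h)
  -- cubic inner products of the pole with the bonds
  obtain ⟨su, sv, st⟩ := inner_bonds_cubic S
  rw [← hadef, ← hbdef] at su
  rw [← hadef, ← hcdef] at sv
  rw [← hbdef, ← hcdef] at st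
  have s_tu : ⟪barlowPos 1 (Real.sqrt (2 / 3)) constHagg 1 (-1) 0, S⟫_ℝ = (c - a) / 2 := by rw [e_tu, inner_sub_left, st, su]; ring
  have s_vu : ⟪barlowPos 1 (Real.sqrt (2 / 3)) constHagg 0 (-1) 1, S⟫_ℝ = (c - b) / 2 := by rw [e_vu, inner_sub_left, sv, su]; ring
  have s_tv : ⟪barlowPos 1 (Real.sqrt (2 / 3)) constHagg 1 0 (-1), S⟫_ℝ = (b - a) / 2 := by rw [e_tv, inner_sub_left, st, sv]; ring
  -- a pair of witnesses gives the bound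
  have fin : ∀ w₁ w₂ : EuclideanSpace ℝ (Fin 3), w₁ ≠ w₂ →
      (A w₁ ∈ U₀.image (fun d => A d) ∧ (⟪A w₁, ν⟫_ℝ < 0 ∧ ((∃ u ∈ K, 1 / 2 < ⟪u, A w₁⟫_ℝ) ∨ ⟪A w₁, ν⟫_ℝ ≤ -t))) →
      (A w₂ ∈ U₀.image (fun d => A d) ∧ (⟪A w₂, ν⟫_ℝ < 0 ∧ ((∃ u ∈ K, 1 / 2 < ⟪u, A w₂⟫_ℝ) ∨ ⟪A w₂, ν⟫_ℝ ≤ -t))) →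
      (2 : ℝ) ≤ (((U₀.image fun d => A d).filter fun d =>
          ⟪d, ν⟫_ℝ < 0 ∧ ((∃ u ∈ K, 1 / 2 < ⟪u, d⟫_ℝ) ∨ ⟪d, ν⟫_ℝ ≤ -t)).card : ℝ) := by
    intro w₁ w₂ hne12 h1 h2
    have h := two_le_card_filter_of_pair h1.1 h2.1 (fun h => hne12 (A.injective h))
      (P := fun d => ⟪d, ν⟫_ℝ < 0 ∧ ((∃ u ∈ K, 1 / 2 < ⟪u, d⟫_ℝ) ∨ ⟪d, ν⟫_ℝ ≤ -t)) h1.2 h2.2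
    exact_mod_cast h
  by_cases ht2 : t ≤ (a + c) / 2
  · -- steep: `A t` and `A v`
    exact fin (barlowPos 1 (Real.sqrt (2 / 3)) constHagg 1 0 0) (barlowPos 1 (Real.sqrt (2 / 3)) constHagg 0 0 1) (ne (by decide)) ⟨m_t, by rw [hνS, st]; linarith, Or.inr (by rw [hνS, st]; linarith)⟩
      ⟨m_v, by rw [hνS, sv]; linarith, Or.inr (by rw [hνS, sv]; linarith)⟩
  push Not at ht2
  -- a contact other than `A t`
  obtain ⟨u, huK, hut⟩ : ∃ u ∈ K, u ≠ A (barlowPos 1 (Real.sqrt (2 / 3)) constHagg 1 0 0) := by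
    obtain ⟨p, q, hpq, hKpq⟩ := card_eq_two.1 hK
    by_cases hp : p = A (barlowPos 1 (Real.sqrt (2 / 3)) constHagg 1 0 0)
    · exact ⟨q, by rw [hKpq]; simp, fun h => hpq (hp.trans h.symm)⟩
    · exact ⟨p, by rw [hKpq]; simp, hp⟩
  obtain ⟨hun, huν⟩ := hK1 u huK
  set u' := A.symm u with hu'def
  set x := u' 0 + Real.sqrt 3 / 3 * u' 1 - Real.sqrt (2 / 3) * u' 2 with hxdef
  set y := u' 0 - Real.sqrt 3 / 3 * u' 1 + Real.sqrt (2 / 3) * u' 2 with hydef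
  set z := 2 * Real.sqrt 3 / 3 * u' 1 + Real.sqrt (2 / 3) * u' 2 with hzdef
  have hu'n : ‖u'‖ = 1 := by rw [hu'def, LinearIsometryEquiv.norm_map, hun]
  have hu2 : x ^ 2 + y ^ 2 + z ^ 2 = 2 := by
    have h := cubic_inner u' u'
    rw [real_inner_self_eq_norm_sq, hu'n] at h
    rw [hxdef, hydef, hzdef]; nlinarith [h]
  have hAu' : A u' = u := by rw [hu'def, LinearIsometryEquiv.apply_symm_apply]
  -- depth
  have hdepth : ⟪u', S⟫_ℝ = -⟪u, ν⟫_ℝ := by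
    have := hνS u'
    rw [hAu'] at this
    linarith
  have hdc : a + c < a * x + b * y + c * z := by
    have h := cubic_inner u' S
    rw [← hxdef, ← hydef, ← hzdef, ← hadef, ← hbdef, ← hcdef, hdepth] at h
    linarith
  -- `u' ≠ t`
  have hne : ¬ (x = 0 ∧ y = 1 ∧ z = 1) := by
    rintro ⟨hx0, hy1, hz1⟩
    apply hut
    rw [← hAu', eq_bondT_of_cubic u' (by rw [← hxdef]; exact hx0) (by rw [← hydef]; exact hy1)
      (by rw [← hzdef]; exact hz1)]
  -- inner products of `u` with the moved bonds
  have hub : ∀ w : EuclideanSpace ℝ (Fin 3), ⟪u, A w⟫_ℝ = ⟪u', w⟫_ℝ := by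
    intro w; rw [← hAu', A.inner_map_map]
  obtain ⟨xu, xv, xt⟩ := inner_bonds_cubic u'
  rw [← hxdef, ← hydef] at xu
  rw [← hxdef, ← hzdef] at xv
  rw [← hydef, ← hzdef] at xt
  have iu : ⟪u', barlowPos 1 (Real.sqrt (2 / 3)) constHagg 0 1 0⟫_ℝ = (x + y) / 2 := by rw [real_inner_comm]; exact xu
  have iv : ⟪u', barlowPos 1 (Real.sqrt (2 / 3)) constHagg 0 0 1⟫_ℝ = (x + z) / 2 := by rw [real_inner_comm]; exact xv
  have it : ⟪u', barlowPos 1 (Real.sqrt (2 / 3)) constHagg 1 0 0⟫_ℝ = (y + z) / 2 := by rw [real_inner_comm]; exact xt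
  have i_tu : ⟪u', barlowPos 1 (Real.sqrt (2 / 3)) constHagg 1 (-1) 0⟫_ℝ = (z - x) / 2 := by rw [e_tu, inner_sub_right, it, iu]; ring
  have i_vu : ⟪u', barlowPos 1 (Real.sqrt (2 / 3)) constHagg 0 (-1) 1⟫_ℝ = (z - y) / 2 := by rw [e_vu, inner_sub_right, iv, iu]; ring
  have i_tv : ⟪u', barlowPos 1 (Real.sqrt (2 / 3)) constHagg 1 0 (-1)⟫_ℝ = (y - x) / 2 := by rw [e_tv, inner_sub_right, it, iv]; ring
  -- clean numeric forms of all inner products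
  have nt : ⟪A (barlowPos 1 (Real.sqrt (2 / 3)) constHagg 1 0 0), ν⟫_ℝ = -((b + c) / 2) := by rw [hνS, st]
  have nv : ⟪A (barlowPos 1 (Real.sqrt (2 / 3)) constHagg 0 0 1), ν⟫_ℝ = -((a + c) / 2) := by rw [hνS, sv]
  have nu : ⟪A (barlowPos 1 (Real.sqrt (2 / 3)) constHagg 0 1 0), ν⟫_ℝ = -((a + b) / 2) := by rw [hνS, su]
  have ntu : ⟪A (barlowPos 1 (Real.sqrt (2 / 3)) constHagg 1 (-1) 0), ν⟫_ℝ = -((c - a) / 2) := by rw [hνS, s_tu]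
  have nvu : ⟪A (barlowPos 1 (Real.sqrt (2 / 3)) constHagg 0 (-1) 1), ν⟫_ℝ = -((c - b) / 2) := by rw [hνS, s_vu]
  have ntv : ⟪A (barlowPos 1 (Real.sqrt (2 / 3)) constHagg 1 0 (-1)), ν⟫_ℝ = -((b - a) / 2) := by rw [hνS, s_tv]
  have bt : ⟪u, A (barlowPos 1 (Real.sqrt (2 / 3)) constHagg 1 0 0)⟫_ℝ = (y + z) / 2 := by rw [hub, it]
  have bv : ⟪u, A (barlowPos 1 (Real.sqrt (2 / 3)) constHagg 0 0 1)⟫_ℝ = (x + z) / 2 := by rw [hub, iv]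
  have bu : ⟪u, A (barlowPos 1 (Real.sqrt (2 / 3)) constHagg 0 1 0)⟫_ℝ = (x + y) / 2 := by rw [hub, iu]
  have btu : ⟪u, A (barlowPos 1 (Real.sqrt (2 / 3)) constHagg 1 (-1) 0)⟫_ℝ = (z - x) / 2 := by rw [hub, i_tu]
  have bvu : ⟪u, A (barlowPos 1 (Real.sqrt (2 / 3)) constHagg 0 (-1) 1)⟫_ℝ = (z - y) / 2 := by rw [hub, i_vu]
  have btv : ⟪u, A (barlowPos 1 (Real.sqrt (2 / 3)) constHagg 1 0 (-1))⟫_ℝ = (y - x) / 2 := by rw [hub, i_tv]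
  -- the witness lemma: a blocked, strictly down, moved lattice direction
  have W : ∀ w : EuclideanSpace ℝ (Fin 3), A w ∈ U₀.image (fun d => A d) → ⟪A w, ν⟫_ℝ < 0 → 1 / 2 < ⟪u, A w⟫_ℝ →
      A w ∈ U₀.image (fun d => A d) ∧
        (⟪A w, ν⟫_ℝ < 0 ∧ ((∃ u ∈ K, 1 / 2 < ⟪u, A w⟫_ℝ) ∨ ⟪A w, ν⟫_ℝ ≤ -t)) :=
    fun w hw hdn hbl => ⟨hw, hdn, Or.inl ⟨u, huK, hbl⟩⟩
  -- distinctness of the witnesses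
  have d12 : barlowPos 1 (Real.sqrt (2 / 3)) constHagg 1 0 0 ≠ barlowPos 1 (Real.sqrt (2 / 3)) constHagg 0 0 1 := ne (by decide)
  have d14 : barlowPos 1 (Real.sqrt (2 / 3)) constHagg 1 0 0 ≠ barlowPos 1 (Real.sqrt (2 / 3)) constHagg 1 (-1) 0 := ne (by decide)
  have d25 : barlowPos 1 (Real.sqrt (2 / 3)) constHagg 0 0 1 ≠ barlowPos 1 (Real.sqrt (2 / 3)) constHagg 0 (-1) 1 := ne (by decide)
  have d45 : barlowPos 1 (Real.sqrt (2 / 3)) constHagg 1 (-1) 0 ≠ barlowPos 1 (Real.sqrt (2 / 3)) constHagg 0 (-1) 1 := ne (by decide)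
  have d13 : barlowPos 1 (Real.sqrt (2 / 3)) constHagg 1 0 0 ≠ barlowPos 1 (Real.sqrt (2 / 3)) constHagg 0 1 0 := ne (by decide)
  have d16 : barlowPos 1 (Real.sqrt (2 / 3)) constHagg 1 0 0 ≠ barlowPos 1 (Real.sqrt (2 / 3)) constHagg 1 0 (-1) := ne (by decide)
  have d32 : barlowPos 1 (Real.sqrt (2 / 3)) constHagg 0 1 0 ≠ barlowPos 1 (Real.sqrt (2 / 3)) constHagg 0 0 1 := ne (by decide)
  have d64 : barlowPos 1 (Real.sqrt (2 / 3)) constHagg 1 0 (-1) ≠ barlowPos 1 (Real.sqrt (2 / 3)) constHagg 1 (-1) 0 := ne (by decide)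
  rcases spl2_coords ha hab hbc hS2 hu2 hdc hne with
    ⟨h1, h2⟩ | ⟨h1, h2, h3⟩ | ⟨h1, h2, h3⟩ | ⟨h1, h2, h3, h4⟩ | ⟨h1, h2, h3⟩ | ⟨h1, h2, h3⟩ | ⟨h1, h2, h3⟩ |
      ⟨h1, h2, h3, h4⟩
  · exact fin _ _ d12 (W _ m_t (by rw [nt]; linarith only [hc0, ha, hab]) (by rw [bt]; linarith only [h1])) (W _ m_v (by rw [nv]; linarith only [hc0, ha]) (by rw [bv]; linarith only [h2]))
  · exact fin _ _ d14 (W _ m_t (by rw [nt]; linarith only [hc0, ha, hab]) (by rw [bt]; linarith only [h1])) (W _ m_tu (by rw [ntu]; linarith only [h3]) (by rw [btu]; linarith only [h2]))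
  · exact fin _ _ d25 (W _ m_v (by rw [nv]; linarith only [hc0, ha]) (by rw [bv]; linarith only [h1])) (W _ m_vu (by rw [nvu]; linarith only [h3]) (by rw [bvu]; linarith only [h2]))
  · exact fin _ _ d45 (W _ m_tu (by rw [ntu]; linarith only [h3]) (by rw [btu]; linarith only [h1])) (W _ m_vu (by rw [nvu]; linarith only [h4]) (by rw [bvu]; linarith only [h2]))
  · exact fin _ _ d13 (W _ m_t (by rw [nt]; linarith only [hc0, ha, hab]) (by rw [bt]; linarith only [h1])) (W _ m_u (by rw [nu]; linarith only [h3]) (by rw [bu]; linarith only [h2]))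
  · exact fin _ _ d16 (W _ m_t (by rw [nt]; linarith only [hc0, ha, hab]) (by rw [bt]; linarith only [h1])) (W _ m_tv (by rw [ntv]; linarith only [h3]) (by rw [btv]; linarith only [h2]))
  · exact fin _ _ d32 (W _ m_u (by rw [nu]; linarith only [h3]) (by rw [bu]; linarith only [h1])) (W _ m_v (by rw [nv]; linarith only [hc0, ha]) (by rw [bv]; linarith only [h2]))
  · exact fin _ _ d64 (W _ m_tv (by rw [ntv]; linarith only [h3]) (by rw [btv]; linarith only [h1])) (W _ m_tu (by rw [ntu]; linarith only [h4]) (by rw [btu]; linarith only [h2]))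

/-- **RUNG (registered by name on stmt-Ventures-19144): the cap budget for at most two contacts.**
Every `t > 0`, every rotation, every normal; the pairwise-angle hypothesis is not even needed. -/
theorem frameCapBudget_card_le_two :
    ∀ U₀ : Finset (EuclideanSpace ℝ (Fin 3)),
      (∀ d ∈ U₀, d ∈ fccStacking 1 (Real.sqrt (2 / 3)) ∧ ‖d‖ = 1) → (∀ d ∈ U₀, -d ∈ U₀) → U₀.card = 12 →
      ∀ A : EuclideanSpace ℝ (Fin 3) ≃ₗᵢ[ℝ] EuclideanSpace ℝ (Fin 3),
      ∀ ν : EuclideanSpace ℝ (Fin 3), ‖ν‖ = 1 → ∀ t : ℝ, 0 < t →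
        ∀ K : Finset (EuclideanSpace ℝ (Fin 3)), K.card ≤ 2 →
        (∀ u ∈ K, ‖u‖ = 1 ∧ ⟪u, ν⟫_ℝ ≤ -t) → (∀ u ∈ K, ∀ u' ∈ K, u ≠ u' → ⟪u, u'⟫_ℝ ≤ 1 / 2) →
        (K.card : ℝ) ≤
          (((U₀.image fun d => A d).filter fun d =>
              ⟪d, ν⟫_ℝ < 0 ∧ ((∃ u ∈ K, 1 / 2 < ⟪u, d⟫_ℝ) ∨ ⟪d, ν⟫_ℝ ≤ -t)).card : ℝ)
            + (1 / 2) * (((U₀.image fun d => A d).filter fun d =>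
              ⟪d, ν⟫_ℝ = 0 ∧ ∃ u ∈ K, 1 / 2 < ⟪u, d⟫_ℝ).card : ℝ) := by
  classical
  intro U₀ hU₀ hU₀neg hU₀card A ν hν t _ K hK hK1 _
  rcases Nat.lt_or_ge K.card 2 with hlt | hge
  · exact frameCapBudget_card_le_one U₀ hU₀ hU₀card A ν hν t K (by omega) hK1
  have hK2 : K.card = 2 := le_antisymm hK hge
  have hnn : (0 : ℝ) ≤ (((U₀.image fun d => A d).filter fun d =>
      ⟪d, ν⟫_ℝ = 0 ∧ ∃ u ∈ K, 1 / 2 < ⟪u, d⟫_ℝ).card : ℝ) := Nat.cast_nonneg _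
  -- chamber: replace `A` by `A ∘ g⁻¹` with the cubic coordinates of `g (A⁻¹ (−ν))` sorted
  obtain ⟨fA, hfA⟩ : ∃ f : EuclideanSpace ℝ (Fin 3) → ℝ,
      ∀ x, f x = x 0 + Real.sqrt 3 / 3 * x 1 - Real.sqrt (2 / 3) * x 2 := ⟨_, fun x => rfl⟩
  obtain ⟨fB, hfB⟩ : ∃ f : EuclideanSpace ℝ (Fin 3) → ℝ,
      ∀ x, f x = x 0 - Real.sqrt 3 / 3 * x 1 + Real.sqrt (2 / 3) * x 2 := ⟨_, fun x => rfl⟩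
  obtain ⟨fC, hfC⟩ : ∃ f : EuclideanSpace ℝ (Fin 3) → ℝ,
      ∀ x, f x = 2 * Real.sqrt 3 / 3 * x 1 + Real.sqrt (2 / 3) * x 2 := ⟨_, fun x => rfl⟩
  obtain ⟨g, hG, h1, h2, h3⟩ := exists_latticeIsometry_cubic_sorted_nonneg fA fB fC hfA hfB hfC (A.symm (-ν))
  set A' : EuclideanSpace ℝ (Fin 3) ≃ₗᵢ[ℝ] EuclideanSpace ℝ (Fin 3) := g.symm.trans A with hA'
  have hA'symm : A'.symm (-ν) = g (A.symm (-ν)) := by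
    rw [hA']; rfl
  have hUeq : (U₀.image fun d => A d) = U₀.image fun d => A' d := by
    ext d
    simp only [mem_image]
    constructor
    · rintro ⟨d₀, hd₀, rfl⟩
      refine ⟨g d₀, fcc_unit_mem_of_bondStar U₀ hU₀ hU₀card (hG.1 d₀ (hU₀ d₀ hd₀).1)
        (by rw [LinearIsometryEquiv.norm_map]; exact (hU₀ d₀ hd₀).2), ?_⟩
      rw [hA', LinearIsometryEquiv.trans_apply, LinearIsometryEquiv.symm_apply_apply]
    · rintro ⟨d₀, hd₀, rfl⟩
      refine ⟨g.symm d₀, fcc_unit_mem_of_bondStar U₀ hU₀ hU₀card (hG.2 d₀ (hU₀ d₀ hd₀).1)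
        (by rw [LinearIsometryEquiv.norm_map]; exact (hU₀ d₀ hd₀).2), ?_⟩
      rw [hA', LinearIsometryEquiv.trans_apply]
  rw [hUeq, hK2]
  have hsort : 0 ≤ (A'.symm (-ν)) 0 + Real.sqrt 3 / 3 * (A'.symm (-ν)) 1 - Real.sqrt (2 / 3) * (A'.symm (-ν)) 2 ∧
      (A'.symm (-ν)) 0 + Real.sqrt 3 / 3 * (A'.symm (-ν)) 1 - Real.sqrt (2 / 3) * (A'.symm (-ν)) 2 ≤
        (A'.symm (-ν)) 0 - Real.sqrt 3 / 3 * (A'.symm (-ν)) 1 + Real.sqrt (2 / 3) * (A'.symm (-ν)) 2 ∧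
      (A'.symm (-ν)) 0 - Real.sqrt 3 / 3 * (A'.symm (-ν)) 1 + Real.sqrt (2 / 3) * (A'.symm (-ν)) 2 ≤
        2 * Real.sqrt 3 / 3 * (A'.symm (-ν)) 1 + Real.sqrt (2 / 3) * (A'.symm (-ν)) 2 := by
    rw [hA'symm, ← hfA, ← hfB, ← hfC]; exact ⟨h1, h2, h3⟩
  have h := frameCapBudget_two_sorted U₀ hU₀ hU₀card A' ν hν t K hK2 hK1 hsort
  push_cast
  linarith

end Summit.Ventures.Crystal3D.Theorems


end
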